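import Mathlib
import HarnessLib
import Summits.NavierStokesRegularity.NavierStokesRegularity.Theorems.PoloidalWindowRigidity.Negative.CrossedSuctionLayers

/-!
# Crux `PoloidalWindowRigidity` (K2, stmt-NavierStokesRegularity-19708), line `local_rigidity` v1 — negative side:
# the local stub `stub_localTHEmpty` (S1) is FALSE WITHOUT ITS SLOPE-GRADIENT CLAUSE `∂_z μ ≠ 0`

Refuter seat ns-regularity-refuter1 (cell ns-regularity-ideate, D-0081 §C; K-READ K-53/K-54, brick K-56), `--supports
stmt-NavierStokesRegularity-19708`, negative side.  The registered stub `stub_localTHEmpty` of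
`Cruxes/PoloidalWindowRigidity/Lines/local_rigidity.lean` (v1; binder-identical to the hypothesis `hempty` of
`…PoloidalWindowDoorLrcModEntireTwistingTHLocal.stub_twistingTH_of_localEmpty`, and — with `μ < 0` appended — to
`stub_localTHEmptyHyp` of `Cruxes/LrcModEntire/Lines/twist_split.lean` v4.1 on the sibling item 20428) says: no real-analytic
`u(t,y)` with analytic slope `μ(t,z)` and pressure datum `A(t,z)` satisfies on an open space–time set the four local (TH) laws
(poloidal, divergence-free, proportional shear `∂₂u_b = μ(t,y₂)∂_bu₂`, the vertical momentum equation with the (TH) pressure law)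
together with, at one point, twist `≠ 0`, `μ ≠ 0`, `μ ≠ 1` and **`∂_z μ ≠ 0`**.

This file shows in the kernel that the last clause is LOAD-BEARING: the three crossed oblique suction layers of
`…Negative.CrossedSuctionLayers` (`crossField a b c`, an exact steady Navier–Stokes flow for all amplitudes) satisfy ALL four
laws on the whole space–time with the CONSTANT slope `μ ≡ −1` and the datum `A(t,z) = 2ac·e^{2z}` (`thLaw_crossField`), and
their twist is `−(b/2)E₂(aE₁ − cE₃)` (`twist_crossField`), nowhere zero for `a = b = 1, c = 0`.  Hence

* `localTHEmpty_false_without_slopeGradient` — the text of S1 VERBATIM with the single point clause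
  `deriv (μ p₀.1) (p₀.2 2) ≠ 0 →` deleted is false (stated inline, `¬ (∀ u μ A U p₀, …)`);
* `localTHEmptyHyp_false_without_slopeGradient` — the same for the v4.1 hyperbolic variant `stub_localTHEmptyHyp` (item 20428;
  `μ < 0` kept: the witness has `μ ≡ −1 < 0`);
* (sequel `…Negative.LocalTHEmptyNUGFalseWithoutSlopeGradient`) the same for the REGISTERED v4.2 normal form
  `stub_localTHEmptyHypNUG` (non-umbilic pin and Galilean rest frame kept) — the witness package below already records the
  non-umbilic pin `∂₀u₀(p₀) ≠ ∂₁u₁(p₀)` for that purpose.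

So any proof or elimination certificate for S1 / `stub_localTHEmptyHyp` must use `∂_z μ ≠ 0` at the base point (the exact
eliminations of nsreg-p7 / cert-1 do: their branches `P16`/`Q18` divide by `μ_z`); the constant-slope sub-system (TH)∩{μ_z = 0}
is NOT empty, it contains genuinely twisting exact Navier–Stokes flows.  (refuter1 K-47's `twistProfile`,
`…LrcModEntire.Negative.TwistedColumn*`, showed the complementary fact that the dynamics `E` is load-bearing.)

WHAT THIS IS NOT: not a refutation of `stub_localTHEmpty`, of the line, or of anything about Navier–Stokes regularity (the
witness is unbounded, not a profile of the Type-I class, and violates the deleted clause by design) — a kernel-checked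
certificate that the clause cannot be dropped (information for the K2 lead's census and for certificate readers).
-/

noncomputable section
-- the summit and its single sub-problem share the name (CONVENTIONS §1), as in every Theorems file
set_option linter.dupNamespace false

namespace Summit.NavierStokesRegularity.NavierStokesRegularity.Theorems.PoloidalWindowRigidity.Negative

open Set Function Filter Topology Metric Real InnerProductSpace WithLp
open scoped Laplacian RealInnerProductSpace ContDiff
open Literature.Analysis Literature.Analysis.FluidPDE


/-! ## The crossed suction layers on the constant-slope stratum `μ ≡ −1` -/

namespace CrossedLayers

variable (a b c : ℝ)

/-- The derivative of the vertical component `v₂ = 2 + (a/2)E₁ + (c/2)E₃ − (b/2)E₂`. [folklore] -/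
theorem hasFDerivAt_crossField_two (y : EuclideanSpace ℝ (Fin 3)) :
    HasFDerivAt (fun x : EuclideanSpace ℝ (Fin 3) => crossField a b c x 2)
      ((a / 2) • (E₁ y • ℓ₁) + (c / 2) • (E₃ y • ℓ₃) - (b / 2) • (E₂ y • ℓ₂)) y := by
  have e : (fun x : EuclideanSpace ℝ (Fin 3) => crossField a b c x 2) = fun x => 2 + (a / 2) * E₁ x + (c / 2) * E₃ x - (b / 2) * E₂ x :=
    funext fun x => crossField_apply_two a b c x
  rw [e]
  exact ((((hasFDerivAt_E₁ y).const_mul (a / 2)).const_add 2).add ((hasFDerivAt_E₃ y).const_mul (c / 2))).sub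
    ((hasFDerivAt_E₂ y).const_mul (b / 2))

/-- **The convective derivative of the vertical component**: `(v·∇)v₂ = ac·E₁E₃ + aE₁ + cE₃ − bE₂`. [folklore] -/
theorem convect_crossField_two (y : EuclideanSpace ℝ (Fin 3)) :
    fderiv ℝ (fun x : EuclideanSpace ℝ (Fin 3) => crossField a b c x 2) y (crossField a b c y) =
      a * c * (E₁ y * E₃ y) + a * E₁ y + c * E₃ y - b * E₂ y := by
  rw [(hasFDerivAt_crossField_two a b c y).fderiv]
  simp
  ring

/-- **The Laplacian of the vertical component**: `Δv₂ = aE₁ + cE₃ − bE₂` (every layer has `|k_j|² = 2`). [folklore] -/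
theorem laplacian_crossField_two (y : EuclideanSpace ℝ (Fin 3)) :
    Δ (fun x : EuclideanSpace ℝ (Fin 3) => crossField a b c x 2) y = a * E₁ y + c * E₃ y - b * E₂ y := by
  have c1 : ∀ k : ℝ, ContDiffAt ℝ 2 (k • E₁) y := fun k => contDiff_E₁.contDiffAt.const_smul k
  have c2 : ∀ k : ℝ, ContDiffAt ℝ 2 (k • E₂) y := fun k => contDiff_E₂.contDiffAt.const_smul k
  have c3 : ∀ k : ℝ, ContDiffAt ℝ 2 (k • E₃) y := fun k => contDiff_E₃.contDiffAt.const_smul k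
  have k2 : ContDiffAt ℝ 2 (fun _ : EuclideanSpace ℝ (Fin 3) => (2 : ℝ)) y := contDiffAt_const
  have e : (fun x : EuclideanSpace ℝ (Fin 3) => crossField a b c x 2) =
      (fun _ => (2 : ℝ)) + (a / 2) • E₁ + (c / 2) • E₃ - (b / 2) • E₂ := by
    funext x; simp [smul_eq_mul]
  have s1 : ContDiffAt ℝ 2 ((fun _ : EuclideanSpace ℝ (Fin 3) => (2 : ℝ)) + (a / 2) • E₁) y := k2.add (c1 _)
  have s2 : ContDiffAt ℝ 2 ((fun _ : EuclideanSpace ℝ (Fin 3) => (2 : ℝ)) + (a / 2) • E₁ + (c / 2) • E₃) y := s1.add (c3 _)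
  rw [e, s2.laplacian_sub (c2 _), s1.laplacian_add (c3 _), k2.laplacian_add (c1 _),
    laplacian_smul _ contDiff_E₁.contDiffAt, laplacian_smul _ contDiff_E₂.contDiffAt,
    laplacian_smul _ contDiff_E₃.contDiffAt, laplacian_E₁, laplacian_E₂, laplacian_E₃, laplacian_const]
  simp only [Pi.zero_apply, smul_eq_mul]
  ring

/-- The vertical stretching `∂₂v₂ = (a/2)E₁ + (c/2)E₃ + (b/2)E₂` as a function. [folklore] -/
theorem dz_crossField_two_eq :
    (fun x : EuclideanSpace ℝ (Fin 3) => fderiv ℝ (crossField a b c) x (EuclideanSpace.single 2 1) 2) =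
      fun x => (a / 2) * E₁ x + (c / 2) * E₃ x + (b / 2) * E₂ x := by
  funext x
  rw [fderiv_crossField_single]
  simp [jac]

/-- The derivative of the vertical stretching. [folklore] -/
theorem hasFDerivAt_dz_crossField_two (y : EuclideanSpace ℝ (Fin 3)) :
    HasFDerivAt (fun x : EuclideanSpace ℝ (Fin 3) => fderiv ℝ (crossField a b c) x (EuclideanSpace.single 2 1) 2)
      ((a / 2) • (E₁ y • ℓ₁) + (c / 2) • (E₃ y • ℓ₃) + (b / 2) • (E₂ y • ℓ₂)) y := by
  rw [dz_crossField_two_eq]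
  exact (((hasFDerivAt_E₁ y).const_mul (a / 2)).add ((hasFDerivAt_E₃ y).const_mul (c / 2))).add
    ((hasFDerivAt_E₂ y).const_mul (b / 2))

/-- **The twist of the crossed layers**: `∂₀(∂₂v₂)·∂₁v₂ − ∂₁(∂₂v₂)·∂₀v₂ = −(b/2)E₂(aE₁ − cE₃)` — nowhere zero as soon as
`b ≠ 0` and `aE₁ ≠ cE₃` (e.g. `c = 0 ≠ a`). [folklore] -/
theorem twist_crossField (y : EuclideanSpace ℝ (Fin 3)) :
    fderiv ℝ (fun x : EuclideanSpace ℝ (Fin 3) => fderiv ℝ (crossField a b c) x (EuclideanSpace.single 2 1) 2) y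
          (EuclideanSpace.single 0 1) * fderiv ℝ (crossField a b c) y (EuclideanSpace.single 1 1) 2 -
        fderiv ℝ (fun x : EuclideanSpace ℝ (Fin 3) => fderiv ℝ (crossField a b c) x (EuclideanSpace.single 2 1) 2) y
          (EuclideanSpace.single 1 1) * fderiv ℝ (crossField a b c) y (EuclideanSpace.single 0 1) 2 =
      -(b / 2) * E₂ y * (a * E₁ y - c * E₃ y) := by
  rw [(hasFDerivAt_dz_crossField_two a b c y).fderiv, fderiv_crossField_single, fderiv_crossField_single]
  simp [jac]
  ring

/-- **The (TH) vertical momentum law holds with CONSTANT slope `μ ≡ −1` and datum `A(t,z) = 2ac·e^{2z}`**: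
`(1−μ)(∂ₜv₂ + v·∇v₂ − Δv₂) = A + (μ_t − μ_zz)v₂ + (μ_z/2)v₂² − 2μ_z∂₂v₂` reduces, all slope derivatives vanishing, to
`2(v·∇v₂ − Δv₂) = 2ac·E₁E₃ = 2ac·e^{2y₂}` (= `−2∂₂p` for the pressure of `…CrossedSuctionLayers`). [folklore] -/
theorem thLaw_crossField (t : ℝ) (y : EuclideanSpace ℝ (Fin 3)) :
    (1 - (fun _ _ : ℝ => (-1 : ℝ)) t (y 2)) *
        (deriv (fun s : ℝ => (fun _ : ℝ => crossField a b c) s y 2) t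
          + fderiv ℝ (fun x : EuclideanSpace ℝ (Fin 3) => (fun _ : ℝ => crossField a b c) t x 2) y ((fun _ : ℝ => crossField a b c) t y)
          - Δ (fun x : EuclideanSpace ℝ (Fin 3) => (fun _ : ℝ => crossField a b c) t x 2) y) =
      (fun _ z : ℝ => 2 * a * c * exp (2 * z)) t (y 2)
        + (deriv (fun s : ℝ => (fun _ _ : ℝ => (-1 : ℝ)) s (y 2)) t - deriv (deriv ((fun _ _ : ℝ => (-1 : ℝ)) t)) (y 2))
          * (fun _ : ℝ => crossField a b c) t y 2
        + deriv ((fun _ _ : ℝ => (-1 : ℝ)) t) (y 2) / 2 * (fun _ : ℝ => crossField a b c) t y 2 ^ 2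
        - 2 * deriv ((fun _ _ : ℝ => (-1 : ℝ)) t) (y 2) *
          fderiv ℝ ((fun _ : ℝ => crossField a b c) t) y (EuclideanSpace.single 2 1) 2 := by
  beta_reduce
  rw [convect_crossField_two, laplacian_crossField_two]
  have hE : E₁ y * E₃ y = exp (2 * y 2) := by
    rw [E₁, E₃, ← exp_add]; ring_nf
  simp only [deriv_const', deriv_const, sub_zero, zero_mul, mul_zero, add_zero, zero_div, zero_add]
  rw [← hE]
  ring

/-- **THE WITNESS PACKAGE.**  `u(t,y) = crossField 2 1 0 y` (two crossed layers, steady), `μ ≡ −1`, `A ≡ 0`, `U = ℝ × ℝ³`,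
`p₀ = (0,0)`: all four local (TH) laws hold everywhere; at `p₀` the twist is `−E₁E₂ = −1 ≠ 0`, `μ = −1 ∉ {0,1}`, `μ < 0`, the
point is NON-UMBILIC (`∂₀u₀ = −1 ≠ −½ = ∂₁u₁`), and the slope gradient `∂_zμ` VANISHES (the deleted clause fails, as it must).
[folklore] -/
theorem crossField_localTHSystem :
    ∃ (u : ℝ → EuclideanSpace ℝ (Fin 3) → EuclideanSpace ℝ (Fin 3)) (μ A : ℝ → ℝ → ℝ)
      (U : Set (ℝ × EuclideanSpace ℝ (Fin 3))) (p₀ : ℝ × EuclideanSpace ℝ (Fin 3)),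
      IsOpen U ∧ p₀ ∈ U ∧
      AnalyticOnNhd ℝ (Function.uncurry u) U ∧
      (∀ p ∈ U, AnalyticAt ℝ (Function.uncurry μ) (p.1, p.2 2)) ∧
      (∀ p ∈ U, AnalyticAt ℝ (Function.uncurry A) (p.1, p.2 2)) ∧
      (∀ p ∈ U, fderiv ℝ (u p.1) p.2 (EuclideanSpace.single 0 1) 1 = fderiv ℝ (u p.1) p.2 (EuclideanSpace.single 1 1) 0) ∧
      (∀ p ∈ U, fderiv ℝ (u p.1) p.2 (EuclideanSpace.single 0 1) 0 + fderiv ℝ (u p.1) p.2 (EuclideanSpace.single 1 1) 1 +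
        fderiv ℝ (u p.1) p.2 (EuclideanSpace.single 2 1) 2 = 0) ∧
      (∀ p ∈ U, ∀ b : Fin 3, b ≠ 2 →
        fderiv ℝ (u p.1) p.2 (EuclideanSpace.single 2 1) b =
          μ p.1 (p.2 2) * fderiv ℝ (u p.1) p.2 (EuclideanSpace.single b 1) 2) ∧
      (∀ p ∈ U,
        (1 - μ p.1 (p.2 2)) *
            (deriv (fun s => u s p.2 2) p.1 + fderiv ℝ (fun y => u p.1 y 2) p.2 (u p.1 p.2)
              - Δ (fun y => u p.1 y 2) p.2) =
          A p.1 (p.2 2) + (deriv (fun s => μ s (p.2 2)) p.1 - deriv (deriv (μ p.1)) (p.2 2)) * u p.1 p.2 2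
            + deriv (μ p.1) (p.2 2) / 2 * u p.1 p.2 2 ^ 2
            - 2 * deriv (μ p.1) (p.2 2) * fderiv ℝ (u p.1) p.2 (EuclideanSpace.single 2 1) 2) ∧
      fderiv ℝ (fun y => fderiv ℝ (u p₀.1) y (EuclideanSpace.single 2 1) 2) p₀.2 (EuclideanSpace.single 0 1) *
            fderiv ℝ (u p₀.1) p₀.2 (EuclideanSpace.single 1 1) 2 -
          fderiv ℝ (fun y => fderiv ℝ (u p₀.1) y (EuclideanSpace.single 2 1) 2) p₀.2 (EuclideanSpace.single 1 1) *
            fderiv ℝ (u p₀.1) p₀.2 (EuclideanSpace.single 0 1) 2 ≠ 0 ∧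
      μ p₀.1 (p₀.2 2) ≠ 0 ∧ μ p₀.1 (p₀.2 2) ≠ 1 ∧ μ p₀.1 (p₀.2 2) < 0 ∧
      (fderiv ℝ (u p₀.1) p₀.2 (EuclideanSpace.single 0 1) 0 ≠ fderiv ℝ (u p₀.1) p₀.2 (EuclideanSpace.single 1 1) 1 ∨
        fderiv ℝ (u p₀.1) p₀.2 (EuclideanSpace.single 1 1) 0 ≠ 0) ∧
      deriv (μ p₀.1) (p₀.2 2) = 0 := by
  refine ⟨fun _ => crossField 2 1 0, fun _ _ => -1, fun _ _ => 0, univ, (0, 0), isOpen_univ, mem_univ _,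
    fun q _ => ((contDiff_crossField 2 1 0 (n := ω)).contDiffAt.analyticAt).comp analyticAt_snd,
    fun _ _ => analyticAt_const, fun _ _ => analyticAt_const, fun p _ => ?_, fun p _ => ?_, fun p _ k hk => ?_,
    fun p _ => ?_, ?_, by norm_num, by norm_num, by norm_num, Or.inl ?_, by simp⟩
  · -- poloidal `∂₀v₁ = ∂₁v₀` (both vanish)
    beta_reduce
    rw [fderiv_crossField_single, fderiv_crossField_single]
    simp [jac]
  · -- divergence free
    beta_reduce
    rw [fderiv_crossField_single, fderiv_crossField_single, fderiv_crossField_single]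
    simp [jac]
    ring
  · -- proportional shear with `μ = −1`
    beta_reduce
    fin_cases k
    · exact (proportionalShear_crossField 2 1 0 p.2).1
    · exact (proportionalShear_crossField 2 1 0 p.2).2
    · exact absurd rfl hk
  · -- the (TH) vertical momentum law, `A = 2·2·0·e^{2z} = 0`
    have h := thLaw_crossField 2 1 0 p.1 p.2
    beta_reduce at h
    beta_reduce
    rw [h]
    ring
  · -- twisting at the origin: `−½·E₂·(2E₁) = −1 ≠ 0`
    beta_reduce
    rw [twist_crossField]
    simp [E₁, E₂, E₃]
  · -- non-umbilic at the origin: `∂₀u₀ = −E₁ = −1`, `∂₁u₁ = −½E₂ = −½`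
    beta_reduce
    rw [fderiv_crossField_single, fderiv_crossField_single]
    simp [jac, E₁, E₂, E₃]

end CrossedLayers

open CrossedLayers

/-! ## The two negative lemmas -/

/-- **S1 WITHOUT `∂_z μ ≠ 0` IS FALSE.**  The negated statement is the text of `stub_localTHEmpty`
(`Cruxes/PoloidalWindowRigidity/Lines/local_rigidity.lean` v1 = hypothesis `hempty` of `…TwistingTHLocal.stub_twistingTH_of_localEmpty`)
VERBATIM with its last point clause `deriv (μ p₀.1) (p₀.2 2) ≠ 0 →` deleted; the crossed suction layers with constant slope `μ ≡ −1`
satisfy every remaining hypothesis.  Any proof of S1 must use the slope-gradient clause at the base point. [folklore] -/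
theorem localTHEmpty_false_without_slopeGradient :
    ¬ (∀ (u : ℝ → EuclideanSpace ℝ (Fin 3) → EuclideanSpace ℝ (Fin 3)) (μ A : ℝ → ℝ → ℝ)
        (U : Set (ℝ × EuclideanSpace ℝ (Fin 3))) (p₀ : ℝ × EuclideanSpace ℝ (Fin 3)),
        IsOpen U → p₀ ∈ U →
        AnalyticOnNhd ℝ (Function.uncurry u) U →
        (∀ p ∈ U, AnalyticAt ℝ (Function.uncurry μ) (p.1, p.2 2)) →
        (∀ p ∈ U, AnalyticAt ℝ (Function.uncurry A) (p.1, p.2 2)) →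
        (∀ p ∈ U, fderiv ℝ (u p.1) p.2 (EuclideanSpace.single 0 1) 1 = fderiv ℝ (u p.1) p.2 (EuclideanSpace.single 1 1) 0) →
        (∀ p ∈ U, fderiv ℝ (u p.1) p.2 (EuclideanSpace.single 0 1) 0 + fderiv ℝ (u p.1) p.2 (EuclideanSpace.single 1 1) 1 +
          fderiv ℝ (u p.1) p.2 (EuclideanSpace.single 2 1) 2 = 0) →
        (∀ p ∈ U, ∀ b : Fin 3, b ≠ 2 →
          fderiv ℝ (u p.1) p.2 (EuclideanSpace.single 2 1) b =
            μ p.1 (p.2 2) * fderiv ℝ (u p.1) p.2 (EuclideanSpace.single b 1) 2) →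
        (∀ p ∈ U,
          (1 - μ p.1 (p.2 2)) *
              (deriv (fun s => u s p.2 2) p.1 + fderiv ℝ (fun y => u p.1 y 2) p.2 (u p.1 p.2)
                - Δ (fun y => u p.1 y 2) p.2) =
            A p.1 (p.2 2) + (deriv (fun s => μ s (p.2 2)) p.1 - deriv (deriv (μ p.1)) (p.2 2)) * u p.1 p.2 2
              + deriv (μ p.1) (p.2 2) / 2 * u p.1 p.2 2 ^ 2
              - 2 * deriv (μ p.1) (p.2 2) * fderiv ℝ (u p.1) p.2 (EuclideanSpace.single 2 1) 2) →
        fderiv ℝ (fun y => fderiv ℝ (u p₀.1) y (EuclideanSpace.single 2 1) 2) p₀.2 (EuclideanSpace.single 0 1) *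
              fderiv ℝ (u p₀.1) p₀.2 (EuclideanSpace.single 1 1) 2 -
            fderiv ℝ (fun y => fderiv ℝ (u p₀.1) y (EuclideanSpace.single 2 1) 2) p₀.2 (EuclideanSpace.single 1 1) *
              fderiv ℝ (u p₀.1) p₀.2 (EuclideanSpace.single 0 1) 2 ≠ 0 →
        μ p₀.1 (p₀.2 2) ≠ 0 → μ p₀.1 (p₀.2 2) ≠ 1 → False) := by
  intro h
  obtain ⟨u, μ, A, U, p₀, hU, hp₀, hu, hμ, hA, hpol, hdiv, hshear, hE, htw, hμ0, hμ1, -, -, -⟩ :=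
    crossField_localTHSystem
  exact h u μ A U p₀ hU hp₀ hu hμ hA hpol hdiv hshear hE htw hμ0 hμ1

/-- **S1-Hyp (v4.1) WITHOUT `∂_z μ ≠ 0` IS FALSE.**  The negated statement is the text of `stub_localTHEmptyHyp`
(`Cruxes/LrcModEntire/Lines/twist_split.lean` v4.1, item 20428 = K2-p2's `hemptyHyp`) VERBATIM with the point clause
`deriv (μ p₀.1) (p₀.2 2) ≠ 0 →` deleted and the hyperbolicity `μ p₀.1 (p₀.2 2) < 0` KEPT: the same witness is hyperbolic
(`μ ≡ −1 < 0`), so the v4.1 sign condition does not rescue the statement once the slope-gradient clause is dropped. [folklore] -/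
theorem localTHEmptyHyp_false_without_slopeGradient :
    ¬ (∀ (u : ℝ → EuclideanSpace ℝ (Fin 3) → EuclideanSpace ℝ (Fin 3)) (μ A : ℝ → ℝ → ℝ)
        (U : Set (ℝ × EuclideanSpace ℝ (Fin 3))) (p₀ : ℝ × EuclideanSpace ℝ (Fin 3)),
        IsOpen U → p₀ ∈ U →
        AnalyticOnNhd ℝ (Function.uncurry u) U →
        (∀ p ∈ U, AnalyticAt ℝ (Function.uncurry μ) (p.1, p.2 2)) →
        (∀ p ∈ U, AnalyticAt ℝ (Function.uncurry A) (p.1, p.2 2)) →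
        (∀ p ∈ U, fderiv ℝ (u p.1) p.2 (EuclideanSpace.single 0 1) 1 = fderiv ℝ (u p.1) p.2 (EuclideanSpace.single 1 1) 0) →
        (∀ p ∈ U, fderiv ℝ (u p.1) p.2 (EuclideanSpace.single 0 1) 0 + fderiv ℝ (u p.1) p.2 (EuclideanSpace.single 1 1) 1 +
          fderiv ℝ (u p.1) p.2 (EuclideanSpace.single 2 1) 2 = 0) →
        (∀ p ∈ U, ∀ b : Fin 3, b ≠ 2 →
          fderiv ℝ (u p.1) p.2 (EuclideanSpace.single 2 1) b =
            μ p.1 (p.2 2) * fderiv ℝ (u p.1) p.2 (EuclideanSpace.single b 1) 2) →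
        (∀ p ∈ U,
          (1 - μ p.1 (p.2 2)) *
              (deriv (fun s => u s p.2 2) p.1 + fderiv ℝ (fun y => u p.1 y 2) p.2 (u p.1 p.2)
                - Δ (fun y => u p.1 y 2) p.2) =
            A p.1 (p.2 2) + (deriv (fun s => μ s (p.2 2)) p.1 - deriv (deriv (μ p.1)) (p.2 2)) * u p.1 p.2 2
              + deriv (μ p.1) (p.2 2) / 2 * u p.1 p.2 2 ^ 2
              - 2 * deriv (μ p.1) (p.2 2) * fderiv ℝ (u p.1) p.2 (EuclideanSpace.single 2 1) 2) →
        fderiv ℝ (fun y => fderiv ℝ (u p₀.1) y (EuclideanSpace.single 2 1) 2) p₀.2 (EuclideanSpace.single 0 1) *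
              fderiv ℝ (u p₀.1) p₀.2 (EuclideanSpace.single 1 1) 2 -
            fderiv ℝ (fun y => fderiv ℝ (u p₀.1) y (EuclideanSpace.single 2 1) 2) p₀.2 (EuclideanSpace.single 1 1) *
              fderiv ℝ (u p₀.1) p₀.2 (EuclideanSpace.single 0 1) 2 ≠ 0 →
        μ p₀.1 (p₀.2 2) ≠ 0 → μ p₀.1 (p₀.2 2) ≠ 1 → μ p₀.1 (p₀.2 2) < 0 → False) := by
  intro h
  obtain ⟨u, μ, A, U, p₀, hU, hp₀, hu, hμ, hA, hpol, hdiv, hshear, hE, htw, hμ0, hμ1, hμneg, -, -⟩ :=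
    crossField_localTHSystem
  exact h u μ A U p₀ hU hp₀ hu hμ hA hpol hdiv hshear hE htw hμ0 hμ1 hμneg


end Summit.NavierStokesRegularity.NavierStokesRegularity.Theorems.PoloidalWindowRigidity.Negative

end
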